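import Summits.AtomisticToContinuum.Crystallization.Theses.PricedLinkCensus

/-!
# IdeatorThreeSketch — crux-ideate stmt-AtomisticToContinuum-14230 (TruncatedCensusGap), ideator 3, round 1

First lemmas of the three idea cards (Ideas/*.md), stated over existing declarations only.
Nothing here is proved; the file must elaborate (`lean check` rc 0, sorries only in `*_holds?` stubs —
there are none: every first lemma is a `def … : Prop`).
-/

noncomputable section

namespace Summit.AtomisticToContinuum.Crystallization.Cruxes.TruncatedCensusGap.Sketch

open Literature.MathematicalPhysics.StatisticalMechanics Literature.Geometry.DiscreteGeometry
open Summit.AtomisticToContinuum.Crystallization.Theses.PricedLinkCensus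

/-- The range-2 truncated Lennard-Jones potential of the crux, `V_χ = χ · V_LJ`,
`χ(r) = min 1 (max 0 (4 − 2r))`. -/
def Vχ (r : ℝ) : ℝ := min 1 (max 0 (4 - 2 * r)) * lennardJones r

/-- `e_χ* = ⨅` over periodic configurations of the `V_χ` energy per particle (the crux's constant). -/
def eStar : ℝ := ⨅ Q : PeriodicConfiguration 3, Q.energyPerParticle Vχ

/-! ## Card A (sharp m-potential + compactness): first lemma = the OPEN MARGIN of charge-freeness at
perfect Barlow patches.  A site whose `3·a`-neighbourhood is two-way `δ·a`-matched to a rigid image of a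
close-packed Barlow stacking of scale `a` (and which is `a/2`-separated there) is charge-free at the fixed
tolerance `1/100`.  This is what makes `{root charged}` a closed set disjoint from the zero set of a sharp
m-potential, so that compactness yields the Peierls constant `κ`. -/
def ChargeFreeOpenAtBarlow : Prop :=
  ∃ δ : ℝ, 0 < δ ∧ ∀ (N : ℕ) (y : Fin N → EuclideanSpace ℝ (Fin 3)) (i : Fin N) (a : ℝ) (s : ℤ → ℤ)
      (g : EuclideanSpace ℝ (Fin 3) ≃ᵃⁱ[ℝ] EuclideanSpace ℝ (Fin 3)),
    0 < a → IsHaggSeq s →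
    (∀ j k : Fin N, j ≠ k → dist (y j) (y i) ≤ 3 * a → a / 2 ≤ dist (y j) (y k)) →
    (∀ j : Fin N, dist (y j) (y i) ≤ 3 * a →
        ∃ z ∈ barlowStacking a (a * Real.sqrt (2 / 3)) s, dist (y j) (g z) ≤ δ * a) →
    (∀ z ∈ barlowStacking a (a * Real.sqrt (2 / 3)) s, dist (g z) (y i) ≤ 3 * a →
        ∃ j : Fin N, dist (y j) (g z) ≤ δ * a) →
    IsChargeFree (1 / 100 : ℝ) y i

/-- Card A, the compactness step in its trivial pointwise shadow (what compactness DELIVERS): a local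
non-negative site functional `h` that sums to the excess and is `≥ κ₀` at charged sites gives the crux.
(The content of the card is producing `κ₀` from the zero set of `h` by compactness; this implication is
bookkeeping and is recorded only to pin the shape of `h`.) -/
def PointwisePricedLocalisationGivesGap : Prop :=
  ∀ (h : (N : ℕ) → (Fin N → EuclideanSpace ℝ (Fin 3)) → Fin N → ℝ) (κ₀ : ℝ), 0 < κ₀ →
    (∀ (N : ℕ) (y : Fin N → EuclideanSpace ℝ (Fin 3)), Function.Injective y →
        ∑ i, h N y i = interactionEnergy Vχ y - (N : ℝ) * eStar) →
    (∀ (N : ℕ) (y : Fin N → EuclideanSpace ℝ (Fin 3)) (i : Fin N), Function.Injective y → 0 ≤ h N y i) →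
    (∀ (N : ℕ) (y : Fin N → EuclideanSpace ℝ (Fin 3)) (i : Fin N), Function.Injective y →
        ¬ IsChargeFree (1 / 100 : ℝ) y i → κ₀ ≤ h N y i) →
    TruncatedCensusGap

/-! ## Card B (metrical-charge coercivity): first lemma = the METRICAL CHARGE GAP with topological
allowance.  `T` = sites charged at EVERY tolerance in `[1/100, 1/50]` (topological charge: surfaces,
missing atoms, five-rings, grain boundaries …); `M` = sites charged at `1/100` all of whose neighbours
within absolute distance `4` (four shells at the Lennard-Jones scale) are charge-free at SOME tolerance in
the window (pure threshold charge in a combinatorially perfect Barlow environment).  Claim: excess plus a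
crude allowance `C` per topological site pays `κ` per metrical site — discrete elasticity only. -/
def MetricalChargeGap : Prop :=
  ∃ κ C : ℝ, 0 < κ ∧ 0 ≤ C ∧ ∀ (N : ℕ) (y : Fin N → EuclideanSpace ℝ (Fin 3)), Function.Injective y →
    (N : ℝ) * eStar
      + κ * (Nat.card {i : Fin N // ¬ IsChargeFree (1 / 100 : ℝ) y i ∧
            ∀ j : Fin N, dist (y i) (y j) ≤ 4 →
              ∃ η ∈ Set.Icc (1 / 100 : ℝ) (1 / 50), IsChargeFree η y j} : ℝ)
      - C * (Nat.card {j : Fin N // ∀ η ∈ Set.Icc (1 / 100 : ℝ) (1 / 50), ¬ IsChargeFree η y j} : ℝ)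
      ≤ interactionEnergy Vχ y

/-- Card B, the complementary TOPOLOGICAL gap (the census's or card A's share): excess pays `κ'` per site
charged at every tolerance of the window.  Strictly weaker than the crux (fewer sites counted). -/
def TopologicalChargeGap : Prop :=
  ∃ κ : ℝ, 0 < κ ∧ ∀ (N : ℕ) (y : Fin N → EuclideanSpace ℝ (Fin 3)), Function.Injective y →
    (N : ℝ) * eStar
      + κ * (Nat.card {j : Fin N // ∀ η ∈ Set.Icc (1 / 100 : ℝ) (1 / 50), ¬ IsChargeFree η y j} : ℝ)
      ≤ interactionEnergy Vχ y

/-- Card B, counting glue (pure combinatorics/packing, no energy): every site charged at `1/100` is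
metrical, or lies within distance `4` of a topological site, or is far from everything at the
Lennard-Jones scale; the last two classes are at most `K` per topological site plus the sites of
zero-energy neighbourhoods, which pay for themselves (`e_i = 0 ≥ e* + |e*|`).  Recorded as the
implication the card needs. -/
def ChargeSplitting : Prop :=
  MetricalChargeGap → TopologicalChargeGap → TruncatedCensusGap

/-! ## Card C (gap-distance slack): first lemma = SLACK GIVES A PAIR-LOCAL LOWER BOUND.  If a radial
`P ≥ 0` vanishing beyond the range `2` can be subtracted from `V_χ` without lowering the periodic
infimum, then the (non-local) excess `E_χ(y) − N e*` dominates the manifestly local, non-negative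
"gap-distance mass" `Σ_{i<j} P(|y_i − y_j|)` of EVERY finite configuration — by linearity of the pair
energy in the potential and the elementary periodisation bound for the finite-range potential `V_χ − P`. -/
def SlackGivesPairLocalBound : Prop :=
  ∀ P : ℝ → ℝ, (∀ r, 0 ≤ P r) → (∀ r, 2 ≤ r → P r = 0) →
    BddBelow (Set.range fun Q : PeriodicConfiguration 3 => Q.energyPerParticle fun r => Vχ r - P r) →
    (⨅ Q : PeriodicConfiguration 3, Q.energyPerParticle fun r => Vχ r - P r) = eStar →
    ∀ (N : ℕ) (y : Fin N → EuclideanSpace ℝ (Fin 3)), Function.Injective y →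
      (N : ℝ) * eStar + interactionEnergy P y ≤ interactionEnergy Vχ y

/-- Card C, the energy-side crux in checkable form (SLACK STABILITY of hcp under gap-rewarding
perturbations): some radial continuous `P ≥ 0`, vanishing beyond `2` and on windows of relative
half-width `1/250` around the six hcp shell radii below `2` (scale `a`, with `a` and the axial ratio
those of the `V_χ`-optimal hcp — quantified existentially here), and at least `c · min(1, dist²)` off
the windows on `[17/20, 2]`, leaves the periodic infimum unchanged. -/
def SlackStability : Prop :=
  ∃ (P : ℝ → ℝ) (a c : ℝ) (W : Finset ℝ), 0 < a ∧ 0 < c ∧ W.card ≤ 8 ∧ Continuous P ∧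
    (∀ r, 0 ≤ P r) ∧ (∀ r, 2 ≤ r → P r = 0) ∧
    (∀ r, 17 / 20 ≤ r → r ≤ 2 →
        c * min 1 ((⨅ w : W, max 0 (|r - (w : ℝ)| - a / 250)) ^ 2) ≤ P r) ∧
    BddBelow (Set.range fun Q : PeriodicConfiguration 3 => Q.energyPerParticle fun r => Vχ r - P r) ∧
    (⨅ Q : PeriodicConfiguration 3, Q.energyPerParticle fun r => Vχ r - P r) = eStar

end Summit.AtomisticToContinuum.Crystallization.Cruxes.TruncatedCensusGap.Sketch

end
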